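import Literature.Analysis.FluidPDE.AxisymNoSwirlVorticity
import Literature.Analysis.FluidPDE.SwirlCutoff
import HarnessLib

/-!
# The poloidal part `V^a = V_ϱ e_ϱ + V₃ e₃` of a vector field: algebra and calculus off the axis

Analysis/FluidPDE support file on the decomposition path of the named fact
`SereginZajaczkowski2007.OffAxisPoloidalBound` (G. Seregin, W. Zajaczkowski, SIAM J. Math. Anal.
39 (2007) 669–685 = arXiv:math/0702720, Lemma 4.2). That lemma bounds the poloidal part
`V^a = (V_ϱ, V₃)` of an axially symmetric solution through the component `χ = ω_φ` of its
vorticity, using the identities (4.3) `V_{ϱ,ϱ} + V_{3,3} = -V_ϱ/ϱ` (incompressibility written for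
the poloidal part), (4.4) `V_{ϱ,3} - V_{3,ϱ} = χ` (the `φ`-component of the curl only sees the
poloidal part) and, after multiplication by a cut-off `ψ`, (4.6)–(4.7).

Here the poloidal part is introduced as a vector field on `ℝ³`,
`poloidalPart u y = u y - u_φ(y) e_φ(y)` (accepted `swirlVelocity`, `eTheta`), and the
coordinate-free content of (4.3)–(4.4) is proved at points off the axis where `u` is
differentiable and axially symmetric along the orbit of the point:

* algebra: `poloidalPart_eq_sub_smul_rotGen` (`V^a = V - (Γ/ϱ²) J`, `Γ` the swirl, `J y = (-y₁, y₀, 0)`),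
  `swirl_poloidalPart` (`V^a` is swirl free), `norm_poloidalPart_sq`
  (`|V^a|² = |V|² - V_φ²`), `norm_poloidalPart_le` (`|V^a| ≤ |V|`), `poloidalPart_rotZ`
  (equivariance);
* calculus: `contDiffAt_poloidalPart`; `fderiv_apply_rotGen_eq_zero_of_forall_rotZ` (a scalar
  constant along the orbit of `y` has `∂_φ = 0` at `y`); **(4.3)** `divergence_poloidalPart`
  (`div V^a = div V` — the swirl part `(Γ/ϱ²) J` is divergence free because `Γ/ϱ²` is constant
  along orbits and `div J = 0`); **(4.4)** `inner_curl_poloidalPart_rotGen`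
  (`⟪curl V^a, J⟫ = ⟪curl V, J⟫`, i.e. `(curl V^a)_φ = ω_φ` — because `⟪curl (g J), J⟫ = 0` for
  every scalar `g`, `inner_curl_smul_rotGen_rotGen`).

Everything is pointwise; no integration. One definition (`poloidalPart`).

## References

* G. Seregin, W. Zajaczkowski, SIAM J. Math. Anal. 39 (2007) 669–685, arXiv:math/0702720, §4,
  Lemma 4.2: `V^a = (V_ϱ, V₃)`, (4.3)–(4.4). [`SereginZajaczkowski2007`]
-/

noncomputable section

open Set Function Filter Topology InnerProductSpace WithLp
open scoped RealInnerProductSpace Topology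

namespace Literature.Analysis.FluidPDE

/-! ### The poloidal part -/

/-- The **poloidal part** `V^a = V - V_φ e_φ = V_ϱ e_ϱ + V₃ e₃` of a vector field on `ℝ³`
(Seregin–Zajaczkowski 2007, Lemma 4.2: "`V^a = (V_ϱ, V₃)`", regarded as the vector field
`V_ϱ e_ϱ + V₃ e₃`), with the accepted `swirlVelocity V y = ⟪V y, e_φ y⟫` and `eTheta`. On the
axis `eTheta` has the junk value `0`, so there `poloidalPart V y = V y`.
[cite: SereginZajaczkowski2007, Lemma 4.2 (V^a = (V_ϱ, V₃))] -/
def poloidalPart (u : EuclideanSpace ℝ (Fin 3) → EuclideanSpace ℝ (Fin 3))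
    (y : EuclideanSpace ℝ (Fin 3)) : EuclideanSpace ℝ (Fin 3) :=
  u y - swirlVelocity u y • eTheta y

variable {u : EuclideanSpace ℝ (Fin 3) → EuclideanSpace ℝ (Fin 3)} {y : EuclideanSpace ℝ (Fin 3)}

/-- Unfolding `poloidalPart`. [folklore] -/
theorem poloidalPart_apply (u : EuclideanSpace ℝ (Fin 3) → EuclideanSpace ℝ (Fin 3))
    (y : EuclideanSpace ℝ (Fin 3)) : poloidalPart u y = u y - swirlVelocity u y • eTheta y :=
  rfl

/-- `x₀² + x₁² = ϱ²` is nonzero off the axis. [folklore] -/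
theorem sq_add_sq_eq_cylRadius_sq (y : EuclideanSpace ℝ (Fin 3)) :
    y 0 ^ 2 + y 1 ^ 2 = cylRadius y ^ 2 :=
  (cylRadius_sq y).symm

/-- **`V^a = V - (Γ/ϱ²) J`** with `Γ = swirl V = x₀V₁ - x₁V₀` and `J y = (-y₁, y₀, 0)`: the form
used for calculus (everything polynomial except `ϱ⁻²`). Valid everywhere (on the axis both
correction terms vanish). [folklore] -/
theorem poloidalPart_eq_sub_smul_rotGen (u : EuclideanSpace ℝ (Fin 3) → EuclideanSpace ℝ (Fin 3))
    (y : EuclideanSpace ℝ (Fin 3)) :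
    poloidalPart u y = u y - (swirl u y / cylRadius y ^ 2) • rotGen y := by
  rw [poloidalPart_apply]
  congr 1
  by_cases hy : cylRadius y = 0
  · have h1 : swirlVelocity u y = 0 := by simp [swirlVelocity, eTheta, hy]
    simp [h1, hy]
  · rw [rotGen_eq_cylRadius_smul_eTheta hy, smul_smul,
      swirl_eq_cylRadius_mul_swirlVelocity u hy]
    congr 1
    field_simp

/-- Components of the poloidal part: `(V^a)₀ = V₀ + Γ x₁/ϱ²`, `(V^a)₁ = V₁ - Γ x₀/ϱ²`,
`(V^a)₂ = V₂`. [folklore] -/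
theorem poloidalPart_apply_coord (u : EuclideanSpace ℝ (Fin 3) → EuclideanSpace ℝ (Fin 3))
    (y : EuclideanSpace ℝ (Fin 3)) :
    poloidalPart u y 0 = u y 0 + swirl u y / cylRadius y ^ 2 * y 1 ∧
      poloidalPart u y 1 = u y 1 - swirl u y / cylRadius y ^ 2 * y 0 ∧
      poloidalPart u y 2 = u y 2 := by
  rw [poloidalPart_eq_sub_smul_rotGen]
  refine ⟨?_, ?_, ?_⟩ <;> simp [rotGen]

/-- **The poloidal part is swirl free**: `swirl V^a = 0` (`Γ(V^a) = Γ(V) - (Γ/ϱ²) ⟪J, J⟫ = 0`).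
[folklore] -/
theorem swirl_poloidalPart (u : EuclideanSpace ℝ (Fin 3) → EuclideanSpace ℝ (Fin 3))
    (y : EuclideanSpace ℝ (Fin 3)) : swirl (poloidalPart u) y = 0 := by
  obtain ⟨h0, h1, -⟩ := poloidalPart_apply_coord u y
  by_cases hy : cylRadius y = 0
  · exact swirl_eq_zero_of_cylRadius_eq_zero _ hy
  · have hr : cylRadius y ^ 2 ≠ 0 := pow_ne_zero 2 hy
    rw [swirl, h0, h1]
    have hs : swirl u y = y 0 * u y 1 - y 1 * u y 0 := rfl
    rw [hs]
    field_simp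
    rw [← sq_add_sq_eq_cylRadius_sq]
    ring

/-- The poloidal part has no swirl (bundled). [folklore] -/
theorem hasNoSwirl_poloidalPart (u : EuclideanSpace ℝ (Fin 3) → EuclideanSpace ℝ (Fin 3)) :
    HasNoSwirl (poloidalPart u) :=
  swirl_poloidalPart u

/-- **`|V^a|² = |V|² - V_φ²`** off the axis (the cylindrical frame is orthonormal). [folklore] -/
theorem norm_poloidalPart_sq (u : EuclideanSpace ℝ (Fin 3) → EuclideanSpace ℝ (Fin 3))
    {y : EuclideanSpace ℝ (Fin 3)} (hy : cylRadius y ≠ 0) :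
    ‖poloidalPart u y‖ ^ 2 = ‖u y‖ ^ 2 - swirlVelocity u y ^ 2 := by
  obtain ⟨h0, h1, h2⟩ := poloidalPart_apply_coord u y
  have hr : cylRadius y ^ 2 ≠ 0 := pow_ne_zero 2 hy
  have hsv : swirlVelocity u y = swirl u y / cylRadius y := by
    rw [swirl_eq_cylRadius_mul_swirlVelocity u hy]
    field_simp
  rw [EuclideanSpace.norm_eq, EuclideanSpace.norm_eq, Real.sq_sqrt (by positivity),
    Real.sq_sqrt (by positivity)]
  simp only [Fin.sum_univ_three, Real.norm_eq_abs, sq_abs, h0, h1, h2, hsv]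
  have hs : swirl u y = y 0 * u y 1 - y 1 * u y 0 := rfl
  have hr2 : cylRadius y ^ 2 = y 0 ^ 2 + y 1 ^ 2 := cylRadius_sq y
  rw [hs]
  field_simp
  linear_combination (-((u y 0) * y 1 - (u y 1) * y 0) ^ 2) * hr2

/-- **`|V^a| ≤ |V|`** (everywhere). [folklore] -/
theorem norm_poloidalPart_le (u : EuclideanSpace ℝ (Fin 3) → EuclideanSpace ℝ (Fin 3))
    (y : EuclideanSpace ℝ (Fin 3)) : ‖poloidalPart u y‖ ≤ ‖u y‖ := by
  by_cases hy : cylRadius y = 0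
  · have h1 : swirlVelocity u y = 0 := by simp [swirlVelocity, eTheta, hy]
    rw [poloidalPart_apply, h1, zero_smul, sub_zero]
  · have h := norm_poloidalPart_sq u hy
    have h2 : ‖poloidalPart u y‖ ^ 2 ≤ ‖u y‖ ^ 2 := by nlinarith [sq_nonneg (swirlVelocity u y)]
    exact le_of_sq_le_sq (by simpa using h2) (norm_nonneg _)

/-! ### Symmetry along the orbit of a point -/

/-- The swirl is constant along an orbit on which the field is equivariant:
`Γ(R_θ y) = Γ(y)` if `u (R_θ y) = R_θ (u y)`. [folklore] -/
theorem swirl_rotZ_of_eq {θ : ℝ} (h : u (rotZ θ y) = rotZ θ (u y)) :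
    swirl u (rotZ θ y) = swirl u y := by
  simp only [swirl, h, rotZ_apply_zero, rotZ_apply_one]
  linear_combination (y 0 * u y 1 - y 1 * u y 0) * Real.sin_sq_add_cos_sq θ

/-- **Equivariance of the poloidal part** along an orbit: `V^a(R_θ y) = R_θ V^a(y)` if
`V (R_θ y) = R_θ V(y)`. [folklore] -/
theorem poloidalPart_rotZ {θ : ℝ} (h : u (rotZ θ y) = rotZ θ (u y)) :
    poloidalPart u (rotZ θ y) = rotZ θ (poloidalPart u y) := by
  rw [poloidalPart_eq_sub_smul_rotGen, poloidalPart_eq_sub_smul_rotGen, swirl_rotZ_of_eq h,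
    cylRadius_rotZ, rotGen_rotZ, h]
  have hlin : ∀ (c : ℝ) (a b : EuclideanSpace ℝ (Fin 3)), rotZ θ (a - c • b) = rotZ θ a - c • rotZ θ b := by
    intro c a b
    have e1 : rotZ θ (a - c • b) = rotZLIE θ (a - c • b) := rfl
    rw [e1, map_sub, map_smul]
    rfl
  rw [hlin]

/-- **A scalar constant along the orbit of `y` has vanishing derivative along `J y`**:
`Dg(y)[J y] = 0` if `g (R_θ y) = g y` for all `θ` (differentiate at `θ = 0`,
`d/dθ R_θ y |₀ = J y`). [folklore] -/
theorem fderiv_apply_rotGen_eq_zero_of_forall_rotZ {g : EuclideanSpace ℝ (Fin 3) → ℝ}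
    (hg : ∀ θ : ℝ, g (rotZ θ y) = g y) (hd : DifferentiableAt ℝ g y) :
    fderiv ℝ g y (rotGen y) = 0 := by
  have h1 : HasDerivAt (fun θ => g (rotZ θ y)) (fderiv ℝ g y (rotGen y)) 0 := by
    have hg' : HasFDerivAt g (fderiv ℝ g y) (rotZ 0 y) := by
      rw [rotZ_zero]; exact hd.hasFDerivAt
    exact hg'.comp_hasDerivAt (0 : ℝ) (hasDerivAt_rotZ_zero y)
  have heq : (fun θ => g (rotZ θ y)) = fun _ => g y := funext hg
  rw [heq] at h1
  exact h1.unique (hasDerivAt_const (0 : ℝ) (g y))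

/-! ### Calculus of the swirl correction `(Γ/ϱ²) J` -/

/-- The swirl of a `Cⁿ` germ is `Cⁿ`. [folklore] -/
theorem contDiffAt_swirl {n : WithTop ℕ∞} (hu : ContDiffAt ℝ n u y) :
    ContDiffAt ℝ n (swirl u) y := by
  rw [swirl_eq_inner_rotGen]
  exact (rotGenL.contDiff.contDiffAt).inner ℝ hu

/-- `ϱ⁻²` is smooth off the axis. [folklore] -/
theorem contDiffAt_inv_cylRadius_sq (hy : cylRadius y ≠ 0) {n : WithTop ℕ∞} :
    ContDiffAt ℝ n (fun x => (cylRadius x ^ 2)⁻¹) y :=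
  ((contDiffAt_cylRadius hy).pow 2).inv (pow_ne_zero 2 hy)

/-- The coefficient `Γ/ϱ²` is `Cⁿ` at a point off the axis where the field is `Cⁿ`. [folklore] -/
theorem contDiffAt_swirl_div_sq {n : WithTop ℕ∞} (hu : ContDiffAt ℝ n u y) (hy : cylRadius y ≠ 0) :
    ContDiffAt ℝ n (fun x => swirl u x / cylRadius x ^ 2) y := by
  simp_rw [div_eq_mul_inv]
  exact (contDiffAt_swirl hu).mul (contDiffAt_inv_cylRadius_sq hy)

/-- The coefficient `Γ/ϱ²` is differentiable at a point off the axis where the field is. [folklore] -/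
theorem differentiableAt_swirl_div_sq (hd : DifferentiableAt ℝ u y) (hy : cylRadius y ≠ 0) :
    DifferentiableAt ℝ (fun x => swirl u x / cylRadius x ^ 2) y := by
  simp_rw [div_eq_mul_inv]
  exact (differentiableAt_swirl hd).mul
    ((contDiffAt_inv_cylRadius_sq hy (n := 1)).differentiableAt (by norm_num))

/-- The poloidal part, as a lambda with the swirl correction (for rewriting under binders).
[folklore] -/
theorem poloidalPart_eq :
    poloidalPart u = fun x => u x - (swirl u x / cylRadius x ^ 2) • rotGen x :=
  funext fun x => poloidalPart_eq_sub_smul_rotGen u x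

/-- **The poloidal part of a `Cⁿ` germ off the axis is `Cⁿ`.** [folklore] -/
theorem contDiffAt_poloidalPart {n : WithTop ℕ∞} (hu : ContDiffAt ℝ n u y) (hy : cylRadius y ≠ 0) :
    ContDiffAt ℝ n (poloidalPart u) y := by
  rw [poloidalPart_eq]
  exact hu.sub ((contDiffAt_swirl_div_sq hu hy).smul rotGenL.contDiff.contDiffAt)

/-- The poloidal part of a field differentiable at a point off the axis is differentiable there.
[folklore] -/
theorem differentiableAt_poloidalPart (hd : DifferentiableAt ℝ u y) (hy : cylRadius y ≠ 0) :
    DifferentiableAt ℝ (poloidalPart u) y := by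
  rw [poloidalPart_eq]
  exact hd.sub ((differentiableAt_swirl_div_sq hd hy).smul (hasFDerivAt_rotGen y).differentiableAt)

/-! ### (4.3): the swirl part is divergence free -/

/-- **(4.3) `div V^a = div V`** at a point off the axis where `V` is differentiable and
equivariant along the orbit of the point (Seregin–Zajaczkowski 2007, (4.3):
`V_{ϱ,ϱ} + V_{3,3} = -V_ϱ/ϱ`, i.e. `div (V_ϱ e_ϱ + V₃ e₃) = div V = 0` for a divergence-free
axially symmetric `V`). The swirl correction `(Γ/ϱ²) J` is divergence free: `Γ/ϱ²` is constant
along the orbit, so its derivative along `J y` vanishes, and `div J = 0`.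
[cite: SereginZajaczkowski2007, Lemma 4.2 proof, (4.3)] -/
theorem divergence_poloidalPart (hd : DifferentiableAt ℝ u y) (hy : cylRadius y ≠ 0)
    (hrot : ∀ θ : ℝ, u (rotZ θ y) = rotZ θ (u y)) :
    VectorCalculus.divergence (poloidalPart u) y = VectorCalculus.divergence u y := by
  have hg : DifferentiableAt ℝ (fun x => swirl u x / cylRadius x ^ 2) y :=
    differentiableAt_swirl_div_sq hd hy
  have hJ : DifferentiableAt ℝ rotGen y := (hasFDerivAt_rotGen y).differentiableAt
  have hw : DifferentiableAt ℝ (fun x => (swirl u x / cylRadius x ^ 2) • rotGen x) y := hg.smul hJ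
  have horbit : ∀ θ : ℝ, swirl u (rotZ θ y) / cylRadius (rotZ θ y) ^ 2 =
      swirl u y / cylRadius y ^ 2 := fun θ => by
    rw [swirl_rotZ_of_eq (hrot θ), cylRadius_rotZ]
  have hzero : fderiv ℝ (fun x => swirl u x / cylRadius x ^ 2) y (rotGen y) = 0 :=
    fderiv_apply_rotGen_eq_zero_of_forall_rotZ horbit hg
  -- `div J = 0` (the generator of rotations is trace free; also recorded in the barrier file
  -- `Barriers/NavierStokesRegularity/NavierStokesInequalitySwirlCalculus`, not imported here)
  have hdivJ : VectorCalculus.divergence rotGen y = 0 := by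
    rw [divergence_eq_sum_inner_fderiv (EuclideanSpace.basisFun (Fin 3) ℝ),
      (hasFDerivAt_rotGen y).fderiv]
    simp [Fin.sum_univ_three, rotGen_single_zero, rotGen_single_one, rotGen_single_two,
      EuclideanSpace.inner_single_left]
  have hsub : VectorCalculus.divergence (fun x => u x - (swirl u x / cylRadius x ^ 2) • rotGen x) y =
      VectorCalculus.divergence u y -
        VectorCalculus.divergence (fun x => (swirl u x / cylRadius x ^ 2) • rotGen x) y := by
    simp only [VectorCalculus.divergence, fderiv_fun_sub hd hw, ContinuousLinearMap.toLinearMap_sub,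
      map_sub]
  rw [poloidalPart_eq, hsub, divergence_smul_apply hg hJ, hdivJ,
    mul_zero, zero_add, real_inner_comm, gradient, InnerProductSpace.toDual_symm_apply, hzero,
    sub_zero]

/-! ### (4.4): the `φ`-component of the curl only sees the poloidal part -/

/-- **`⟪curl (g J), J⟫ = 0`** for every scalar `g` differentiable at the point: in components,
`curl (g J) = (-y₀ ∂₃g, -y₁ ∂₃g, 2g + y₀∂₀g + y₁∂₁g)`, whose horizontal part is radial.
[folklore] -/
theorem inner_curl_smul_rotGen_rotGen {g : EuclideanSpace ℝ (Fin 3) → ℝ} (hg : DifferentiableAt ℝ g y) :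
    ⟪curl (fun x => g x • rotGen x) y, rotGen y⟫ = 0 := by
  have hL : HasFDerivAt (fun x => g x • rotGen x)
      (g y • rotGenL + (fderiv ℝ g y).smulRight (rotGen y)) y :=
    hg.hasFDerivAt.smul (hasFDerivAt_rotGen y)
  rw [real_inner_comm, inner_rotGen_left]
  simp only [curl, hL.fderiv]
  simp [rotGen]
  ring

/-- **(4.4) `(curl V^a)_φ = (curl V)_φ = ω_φ`** in the junk-free form `⟪curl V^a, J⟫ = ⟪curl V, J⟫`
at a point off the axis where `V` is differentiable (Seregin–Zajaczkowski 2007, (4.4):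
`V_{ϱ,3} - V_{3,ϱ} = χ = ω_φ`, i.e. the `φ`-component of the vorticity is computed from the
poloidal part alone). [cite: SereginZajaczkowski2007, Lemma 4.2 proof, (4.4)] -/
theorem inner_curl_poloidalPart_rotGen (hd : DifferentiableAt ℝ u y) (hy : cylRadius y ≠ 0) :
    ⟪curl (poloidalPart u) y, rotGen y⟫ = ⟪curl u y, rotGen y⟫ := by
  have hg : DifferentiableAt ℝ (fun x => swirl u x / cylRadius x ^ 2) y :=
    differentiableAt_swirl_div_sq hd hy
  have hw : DifferentiableAt ℝ (fun x => (swirl u x / cylRadius x ^ 2) • rotGen x) y :=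
    hg.smul (hasFDerivAt_rotGen y).differentiableAt
  rw [poloidalPart_eq, curl_sub hd hw, inner_sub_left, inner_curl_smul_rotGen_rotGen hg, sub_zero]

/-- (4.4) with the unit vector `e_φ = J/ϱ`: `⟪curl V^a, e_φ⟫ = ⟪curl V, e_φ⟫` off the axis
(accepted `swirlVelocity w y = ⟪w y, e_φ y⟫`). [cite: SereginZajaczkowski2007, Lemma 4.2 proof, (4.4)] -/
theorem swirlVelocity_curl_poloidalPart (hd : DifferentiableAt ℝ u y) (hy : cylRadius y ≠ 0) :
    swirlVelocity (curl (poloidalPart u)) y = swirlVelocity (curl u) y := by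
  have h := inner_curl_poloidalPart_rotGen hd hy
  rw [rotGen_eq_cylRadius_smul_eTheta hy, inner_smul_right, inner_smul_right] at h
  have h' := mul_left_cancel₀ hy h
  simpa [swirlVelocity] using h'

end Literature.Analysis.FluidPDE
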